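import Summits.Ventures.PercRepro.C026DCSub
import Summits.Ventures.PercRepro.C026SeriesParallel
import Summits.Ventures.PercRepro.C026Recursion
import Summits.Ventures.PercRepro.GladkovThm13

/-!
# The C-026 slack in closed form: `Δ_CF = 2·P(c ↔ {a, b} ∧ a ↮ b) − P(c ↔ {a, b})·P(a ↮ b)` (p6, gen 14)

Write `B = {c ↔ a} ∪ {c ↔ b}` (`c` reaches a mark) and `A = {a ↔ b}`.  Then `B ∩ A = {a ↔ b ↔ c}`,
`B ∩ Aᶜ = ac|b ⊔ bc|a`, and the five rows give `P(B) = x + y₂ + y₃`, `P(Aᶜ) = y₂ + y₃ + z`,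
`P(B ∩ Aᶜ) = y₂ + y₃`.  The C-026 slack `y₁ + y₂ + y₃ − (x + y₁)(y₁ + z)` equals
`2 (y₂ + y₃) − (x + y₂ + y₃)(y₂ + y₃ + z)` on the simplex `x + y₁ + y₂ + y₃ + z = 1`
(`c026_slack_eq`), so

* **`C026At_iff_half`** — C-026 at `p` is exactly the reverse-Harris bound
  `P(B)·P(Aᶜ) ≤ 2·P(B ∩ Aᶜ)`, i.e. `P(a ↮ b | c ↔ {a, b}) ≥ ½·P(a ↮ b)`;
* **`slackCF_eq_two_mul_sub`** — the class-level twin over mine-3's `slackCF` (`p = ½`, complementary pairs):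
  `Δ_CF = 2·#{ω : c ~_ω {a, b} ∧ a ≁_ω b} − #{ω : c ~_ω {a, b} ∧ a ≁_{ωᶜ} b}` — the `ω ↦ ωᶜ` bijection moves
  the closed-cluster clauses of `N_AB` onto `ω` and the pointwise bookkeeping `indicator_closedForm` does the
  rest.

Both are reformulations (supports), not statements of record.
-/

namespace PercRepro

open Finset

namespace MultiGraph

section ClosedFormRows

variable {V E : Type*} (G : MultiGraph V E)

/-! ### The every-`p` form over the five rows -/

/-- `P(B ∩ Aᶜ) = y₂ + y₃`: the rows `ac|b` and `bc|a` are the disjoint halves of `{c ↔ {a, b}} ∩ {a ↮ b}`. -/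
theorem law3_two_add_three [Fintype E] [DecidableEq E] (p : E → ℝ) (a b c : V) :
    G.law3 p a b c 2 + G.law3 p a b c 3 =
      prob p ((G.connEvent c a ∪ G.connEvent c b) ∩ G.sepEvent a b) := by
  rw [law3_two, law3_three, G.partitionEvent_row_ac_b, G.partitionEvent_row_bc_a]
  have h := prob_union_add_inter p (G.connEvent a c ∩ G.sepEvent a b)
    (G.connEvent b c ∩ G.sepEvent a b)
  have e1 : G.connEvent a c ∩ G.sepEvent a b ∪ G.connEvent b c ∩ G.sepEvent a b =
      (G.connEvent c a ∪ G.connEvent c b) ∩ G.sepEvent a b := by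
    ext ω
    simp only [Set.mem_union, Set.mem_inter_iff, mem_connEvent, mem_sepEvent]
    constructor
    · rintro (⟨h1, h2⟩ | ⟨h1, h2⟩)
      · exact ⟨Or.inl h1.symm, h2⟩
      · exact ⟨Or.inr h1.symm, h2⟩
    · rintro ⟨h1 | h1, h2⟩
      · exact Or.inl ⟨h1.symm, h2⟩
      · exact Or.inr ⟨h1.symm, h2⟩
  have e2 : G.connEvent a c ∩ G.sepEvent a b ∩ (G.connEvent b c ∩ G.sepEvent a b) = ∅ := by
    ext ω
    simp only [Set.mem_inter_iff, mem_connEvent, mem_sepEvent, Set.mem_empty_iff_false, iff_false]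
    rintro ⟨⟨h1, h2⟩, ⟨h3, _⟩⟩
    exact h2 (h1.trans h3.symm)
  have e3 : prob p (∅ : Set (Config E)) = 0 := by simp [prob]
  rw [e1, e2, e3] at h
  linarith

/-- `P(B) = x + y₂ + y₃`. -/
theorem law3_zero_add_two_add_three [Fintype E] [DecidableEq E] (p : E → ℝ) (a b c : V) :
    G.law3 p a b c 0 + G.law3 p a b c 2 + G.law3 p a b c 3 =
      prob p (G.connEvent c a ∪ G.connEvent c b) := by
  have h := prob_inter_add_prob_inter_compl p (G.connEvent c a ∪ G.connEvent c b) (G.connEvent a b)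
  have e1 : (G.connEvent c a ∪ G.connEvent c b) ∩ G.connEvent a b =
      G.connEvent a b ∩ G.connEvent b c := by
    ext ω
    simp only [Set.mem_union, Set.mem_inter_iff, mem_connEvent]
    constructor
    · rintro ⟨h1 | h1, h2⟩
      · exact ⟨h2, h2.symm.trans h1.symm⟩
      · exact ⟨h2, h1.symm⟩
    · rintro ⟨h1, h2⟩
      exact ⟨Or.inr h2.symm, h1⟩
  have e2 : (G.connEvent c a ∪ G.connEvent c b) ∩ (G.connEvent a b)ᶜ =
      (G.connEvent c a ∪ G.connEvent c b) ∩ G.sepEvent a b := rfl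
  have h0 : G.law3 p a b c 0 = prob p (G.connEvent a b ∩ G.connEvent b c) := by
    rw [law3_zero, G.partitionEvent_row_abc]
  have h23 := G.law3_two_add_three p a b c
  rw [e1, e2] at h
  linarith

/-- `P(Aᶜ) = y₂ + y₃ + z`. -/
theorem law3_two_add_three_add_four [Fintype E] [DecidableEq E] (p : E → ℝ) (a b c : V) :
    G.law3 p a b c 2 + G.law3 p a b c 3 + G.law3 p a b c 4 = prob p (G.sepEvent a b) := by
  have hsum := law3_sum_eq_one G p a b c
  have h01 := G.law3_zero_add_one p a b c
  have hc : prob p (G.sepEvent a b) = 1 - prob p (G.connEvent a b) := prob_compl p _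
  linarith

/-- The algebra of the closed form: on the simplex `x + y₁ + y₂ + y₃ + z = 1`,
`(y₁ + y₂ + y₃) − (x + y₁)(y₁ + z) = 2 (y₂ + y₃) − (x + y₂ + y₃)(y₂ + y₃ + z)`. -/
theorem c026_slack_eq {x y₁ y₂ y₃ z : ℝ} (hsum : x + y₁ + y₂ + y₃ + z = 1) :
    (y₁ + y₂ + y₃) - (x + y₁) * (y₁ + z) = 2 * (y₂ + y₃) - (x + y₂ + y₃) * (y₂ + y₃ + z) := by
  linear_combination (y₂ + y₃ - y₁) * hsum

end ClosedFormRows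

section ClosedFormAt

variable {V E : Type} (G : MultiGraph V E)

/-- **C-026 in closed form, every `p`**: `C026At` is the reverse-Harris bound
`P(c ↔ {a, b}) · P(a ↮ b) ≤ 2 · P(c ↔ {a, b} ∧ a ↮ b)`, i.e. `P(a ↮ b | c ↔ {a, b}) ≥ ½ · P(a ↮ b)`. -/
theorem C026At_iff_half [Fintype E] [DecidableEq E] (p : E → ℝ) (a b c : V) :
    G.C026At p a b c ↔
      prob p (G.connEvent c a ∪ G.connEvent c b) * prob p (G.sepEvent a b) ≤
        2 * prob p ((G.connEvent c a ∪ G.connEvent c b) ∩ G.sepEvent a b) := by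
  have hsum := law3_sum_eq_one G p a b c
  have key := c026_slack_eq hsum
  rw [← G.law3_zero_add_two_add_three p a b c, ← G.law3_two_add_three_add_four p a b c,
    ← G.law3_two_add_three p a b c]
  unfold C026At
  constructor
  · intro h
    linarith
  · intro h
    linarith

end ClosedFormAt

section ClosedFormClass

variable {V E : Type*} (G : MultiGraph V E)

/-! ### The class-level twin over `slackCF` -/

/-- The pointwise bookkeeping behind the class-level closed form: with `A = a ~ b`, `Cₐ = c ~ a`,
`C_b = c ~ b` read in `ω` and `A' = a ~ b` read in `ωᶜ`, under the transitivity facts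
`Cₐ → C_b → A`, `A → Cₐ → C_b`, `A → C_b → Cₐ`. -/
theorem indicator_closedForm (A Ca Cb A' : Prop) [Decidable A] [Decidable Ca] [Decidable Cb]
    [Decidable A'] (h1 : Ca → Cb → A) (h2 : A → Ca → Cb) (h3 : A → Cb → Ca) :
    ((if A ∧ ¬ Ca then 1 else 0) + (if Ca ∧ ¬ Cb then 1 else 0) + (if Cb ∧ ¬ Ca then 1 else 0) -
        (if A' ∧ ¬ Ca ∧ ¬ Cb then 1 else 0) : ℤ) =
      2 * (if (Ca ∨ Cb) ∧ ¬ A then 1 else 0) - (if (Ca ∨ Cb) ∧ ¬ A' then 1 else 0) +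
        ((if A then 1 else 0) - (if A' then 1 else 0)) := by
  by_cases hA : A <;> by_cases hCa : Ca <;> by_cases hCb : Cb <;> by_cases hA' : A' <;>
    simp [hA, hCa, hCb, hA'] <;>
    first
      | exact absurd (h1 hCa hCb) hA
      | exact absurd (h2 hA hCa) hCb
      | exact absurd (h3 hA hCb) hCa

open Classical in
/-- Reindexing a sum over the configurations by the involution `ω ↦ ωᶜ`. -/
theorem sum_compl_eq [Fintype E] (f : Config E → ℤ) :
    ∑ ω : Config E, f ωᶜ = ∑ ω : Config E, f ω :=
  Fintype.sum_bijective compl compl_involutive.bijective _ _ fun _ => rfl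

/-- A filtered count as a sum of indicators, in `ℤ`. -/
theorem card_filter_int [DecidableEq E] [Fintype E] (P : Config E → Prop) [DecidablePred P] :
    ((univ.filter P).card : ℤ) = ∑ ω : Config E, if P ω then (1 : ℤ) else 0 := by
  rw [Finset.card_filter]
  push_cast
  rfl

open Classical in
/-- **The class-level closed form** of mine-3's slack:
`Δ_CF(G) = 2·#{ω : c ~ {a, b} ∧ a ≁ b} − #{ω : c ~_ω {a, b} ∧ a ≁_{ωᶜ} b}` — the `p = ½` twin of
`C026At_iff_half`, with the census measure `#{ω : B(ω) ∧ Aᶜ(ωᶜ)}` in the role of `P(B)·P(Aᶜ)`. -/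
theorem slackCF_eq_two_mul_sub [Fintype E] (a b c : V) :
    G.slackCF a b c =
      2 * ((univ.filter fun ω : Config E => (G.Conn ω c a ∨ G.Conn ω c b) ∧ ¬ G.Conn ω a b).card : ℤ) -
        ((univ.filter fun ω : Config E =>
          (G.Conn ω c a ∨ G.Conn ω c b) ∧ ¬ G.Conn ωᶜ a b).card : ℤ) := by
  unfold slackCF
  simp only [card_filter_int]
  -- the closed-cluster clauses of `N_AB` move onto `ω` under `ω ↦ ωᶜ`
  have hN := sum_compl_eq (fun ω : Config E =>
    if G.Conn ω a b ∧ ¬ G.Conn ωᶜ c a ∧ ¬ G.Conn ωᶜ c b then (1 : ℤ) else 0)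
  simp only [compl_compl] at hN
  have hbal := sum_compl_eq (fun ω : Config E => if G.Conn ω a b then (1 : ℤ) else 0)
  have hpt : (∑ ω : Config E, ((if G.Conn ω a b ∧ ¬ G.Conn ω a c then (1 : ℤ) else 0) +
          (if G.Conn ω c a ∧ ¬ G.Conn ω c b then (1 : ℤ) else 0) +
          (if G.Conn ω c b ∧ ¬ G.Conn ω c a then (1 : ℤ) else 0) -
          (if G.Conn ωᶜ a b ∧ ¬ G.Conn ω c a ∧ ¬ G.Conn ω c b then (1 : ℤ) else 0))) =
      ∑ ω : Config E, ((2 * (if (G.Conn ω c a ∨ G.Conn ω c b) ∧ ¬ G.Conn ω a b then (1 : ℤ) else 0) -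
          (if (G.Conn ω c a ∨ G.Conn ω c b) ∧ ¬ G.Conn ωᶜ a b then (1 : ℤ) else 0)) +
          ((if G.Conn ω a b then (1 : ℤ) else 0) - (if G.Conn ωᶜ a b then (1 : ℤ) else 0))) := by
    refine Finset.sum_congr rfl fun ω _ => ?_
    have e : (if G.Conn ω a b ∧ ¬ G.Conn ω a c then (1 : ℤ) else 0) =
        (if G.Conn ω a b ∧ ¬ G.Conn ω c a then (1 : ℤ) else 0) := by
      congr 1
      exact propext ⟨fun ⟨h1, h2⟩ => ⟨h1, fun h => h2 h.symm⟩,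
        fun ⟨h1, h2⟩ => ⟨h1, fun h => h2 h.symm⟩⟩
    rw [e]
    exact indicator_closedForm (G.Conn ω a b) (G.Conn ω c a) (G.Conn ω c b) (G.Conn ωᶜ a b)
      (fun h1 h2 => h1.symm.trans h2) (fun h h1 => h1.trans h) (fun h h2 => h2.trans h.symm)
  simp only [Finset.sum_add_distrib, Finset.sum_sub_distrib, ← Finset.mul_sum] at hpt
  linarith

end ClosedFormClass

end MultiGraph

end PercRepro
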